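import Literature.MathematicalPhysics.QuantumFieldTheory.Balaban1983to89.B2Eq237FormSplit
import Literature.MathematicalPhysics.QuantumFieldTheory.Balaban1983to89.B2Eq238ScalarBoundary

/-!
# `Balaban1983to89.B2Eq240ScalarForm` — [Balaban1982Higgs2] (2.40) p. 565: the scalar twin of (2.37) — the split of
`½⟨ψ, Δ^{(1),L}_{Λ₅}(B^{(1)})ψ⟩` along `ψ = Λ′₆ᶜψ + Λ′₆ψ` with the kernel replacements `C^{(0)}_{Λ₅}(B^{(1)}) →
C^{(0)}_{Λ₅}(Λ₇ᶜ, B^{(1)})` (outer part) and `→ C^{(0)}(Λ₂, B^{(1)})` (inner part) — the exact identity PROVED and the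
`O(ε^κ)|Λ₅|` error PROVED from the Prop. I.2.1 / I.2.3 shapes + the separations of (2.8), *"for arbitrary κ"*

statement-level skeleton of published theorems with citation tags; proofs where landed; nothing here is a claim about the Yang–Mills mass gap

PDF held: `paper:balaban1982-cmp86-higgs23-ii` (T. Bałaban, *(Higgs)₂,₃ quantum fields in a finite volume. II. An upper
bound*, Commun. Math. Phys. **86** (1982) 555–594, doi 10.1007/bf01214890; journal page = PDF page + 554); p. 565 [PDF 11]
READ AS AN IMAGE (`run/shared/lean/pub/pub-balaban/b2b-balaban-ref1/pages/1982-cmp86-higgs23-II/…-p011-x2.png`); part I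
[Balaban1982Higgs1] Prop. 2.1 p. 610, (2.21) p. 610, Prop. 2.3 p. 611 [PDF 8–9] read as images likewise.

CITATION HEADER — WHAT IS REPRODUCED.  SKELETON row **B2.Eq2.42** ((2.20)–(2.42)), member **(2.40)** p. 565 (last of the
replacements (2.36)–(2.40); (2.36) `…B2Eq236Replacements`, (2.37) `…B2Eq237FormSplit`, (2.38)–(2.39)
`…B2Eq238ScalarBoundary`).  Unit `lit-balaban-p15` gen 3 (Phase-2 proof seat p15; HOME `run/shared/lean/pub/lit-balaban/`,
seat dir `lit-balaban-p15/`); B2 fold owner r02, second reader r14; referee ref-4.  Inputs by name: r02's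
`B2Eq224FirstStepFields.delta227` and `B2Eq218Translation.restrict`; the (2.37) file's split lemmas and its two error
engines `eq237_far_bound` / `eq237_damped_bound` (used VERBATIM for the far term and the inner term); the (2.38) file's
row-damped engine `bilin_rowdamped_bound`; constants *"for arbitrary κ"* from `decay_thresholds_pow₂` / r14's
`B2StepK.rDecayBeatsPowers`.

WHAT IS PRINTED (p. 565 [PDF 11], verbatim).  *"½⟨ψ, Δ^{(1),L}_{Λ₅}(B^{(1)})ψ⟩ = ½⟨Λ′₆ᶜψ, Δ^{(1),L}_{Λ₅}(Λ₇ᶜ, B^{(1)})Λ′₆ᶜψ⟩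
− a²L⁻⁴⟨Λ′₆ᶜψ, Q(B^{(1)})C^{(0)}_{Λ₅}(Λ₇ᶜ, B^{(1)})Q*(B^{(1)})(Λ′₆∩Λ′₇ᶜ)ψ⟩ + ½⟨Λ′₆ψ, Δ^{(1),L}(Λ₂, B^{(1)})Λ′₆ψ⟩ + O(ε^κ)|Λ₅|.
(2.40)"*, after *"In this case it is convenient to make all the expressions, except the basic quadratic form, independent of
the field B^{(1)}↾_{Λ₇} … This is achieved by imposing proper boundary conditions on the fundamental Laplace difference
operator. We have from Proposition I.2.1."*  The operators: (2.27) p. 562 `⟨ψ, Δ^{(k+1),L}_Λ(Ω, A)ψ⟩ = aL^{d−2}Σ_{y∈Λ′}|ψ(y)|² −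
a²L⁻⁴⟨ψ, Q(A)C^{(k)}_Λ(Ω, A)Q*(A)ψ⟩` (here at `Ω = T` and at `Ω = Λ₇ᶜ`) and the whole-lattice (I.2.21) p. 610
`⟨ψ, Δ^{(k),L^kε}(Ω, A)ψ⟩ = a_k(L^kε)⁻²⟨ψ, ψ⟩ − a_k²(L^kε)⁻⁴⟨ψ, Q_k(A)G^ε_k(Ω, A)Q*_k(A)ψ⟩` (at `Ω = Λ₂`).  The inputs: Prop.
I.2.1 (2.25)–(2.26) p. 610 (the row-damped shape of `G(Ω, A) − G(Ω₀, A)` at distance `≥ R₀` from `Ωᶜ`, quoted in the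
(2.38) file), Prop. I.2.3 (2.34)/(2.36) p. 611 (decay of `C^{(k)}_Λ`, doubly-damped `C^{(k)}_Λ − C^{(k)}`, quoted in the (2.37)
file), the geometry (2.8) p. 558 and the thresholds (2.2)/(2.17).

THE ARGUMENT (the print gives none; the evident one).  `ψ = ψ_o + ψ_i`, `ψ_o = Λ′₆ᶜψ`, `ψ_i = Λ′₆ψ`, `Δ₅ := Δ^{(1),L}_{Λ₅}(B^{(1)})`
symmetric: `½⟨ψ,Δ₅ψ⟩ = ½⟨ψ_o,Δ₅ψ_o⟩ + ⟨ψ_o,Δ₅ψ_i⟩ + ½⟨ψ_i,Δ₅ψ_i⟩`.  (i) `½⟨ψ_o,Δ₅ψ_o⟩ = ½⟨ψ_o,Δ₅(Λ₇ᶜ)ψ_o⟩ −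
½c²⟨ψ_o,Q δ₇C Q*ψ_o⟩`, `δ₇C := C_{Λ₅}(B) − C_{Λ₅}(Λ₇ᶜ,B)`, and `Q*ψ_o`, `Qᵀψ_o` live (inside `Λ₅`) under the blocks of
`Λ′₅∖Λ′₆`, farther than `r(ε)` from `Λ₇` ((2.8)): row-damped, `O(e^{−δ₀r(ε)})`.  (ii) the cross term has no diagonal part
(disjoint supports) and `ψ_i = (Λ′₆∩Λ′₇ᶜ)ψ + Λ′₇ψ`: the `Λ′₇ψ` part is FAR from `ψ_o` (`O(e^{−½δ₀r(ε)})` by (I.2.34)), in the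
other the kernel is replaced at the row-damped cost again — leaving the printed `−c²⟨ψ_o, QC_{Λ₅}(Λ₇ᶜ,B)Q*(Λ′₆∩Λ′₇ᶜ)ψ⟩`.
(iii) `½⟨ψ_i,Δ₅ψ_i⟩ − ½⟨ψ_i,Δ(Λ₂)ψ_i⟩ = −½c²⟨ψ_i,Q(C_{Λ₅}(B) − C(Λ₂,B))Q*ψ_i⟩` (diagonal parts agree on `Λ′₆ ⊆ Λ′₅`), doubly
damped in the depth `dist(·,Λ₅ᶜ) ≥ r(ε)` of the blocks of `Λ′₆` (`C_{Λ₅}(B) − C(B)` by (I.2.36), `C(B) − C(Λ₂,B)` by (I.2.26)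
with `dist(·,Λ₂ᶜ) ≥ dist(·,Λ₅ᶜ)`).  All four are `(thresholds)²·|Λ′₅|·O(e^{−½δ₀r(ε)}) = O(ε^κ)|Λ₅|` for every κ.

DICTIONARY = that of the (2.37)/(2.38) files: `Q`, `Qs = w•Qᵀ`, `c` ↤ `aL⁻²`, `Λ` ↤ `Λ₅`, `Λ' ⊇ Λ₆' ⊇ Λ₇'` ↤ `Λ′₅ ⊇ Λ′₆ ⊇ Λ′₇`,
`CΛ` ↤ `C^{(0)}_{Λ₅}(B^{(1)})` (symmetric, Dirichlet support `hCs`, decay `hK`), `C7` ↤ `C^{(0)}_{Λ₅}(Λ₇ᶜ, B^{(1)})` (Dirichlet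
support `hCs7`, row-damped difference `hδ7` in `v` ↤ `dist(·, Λ₇)`), `C2` ↤ `C^{(0)}(Λ₂, B^{(1)}) = G₀(Λ₂, B^{(1)})` (doubly-damped
difference `hδC2` in `u` ↤ `dist(·, Λ₅ᶜ)` on `Λ₅ × Λ₅`), `restrict S ψ` ↤ `Sψ`; separations ↤ (2.8): `hsep` (blocks of
`Λ′₅∖Λ′₆` vs blocks of `Λ′₇`), `hdeep6` (blocks of `Λ′₆` inside `Λ₅`), `hdeep7` (fine points under blocks of `Λ′₅∖Λ′₆` vs
`Λ₇`); `Gψ` ↤ the threshold for `|ψ|` on `Λ′₅`; `q₁`, `qs₁`, `Ssum` as before.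

WHAT IS KERNEL-CHECKED (zero `sorry`, standard axioms, no definitions).
 §1 `dot_delta227_kernel_sub`, `dot_QKQs_split`, **`eq240_exact`**: `½w⟨ψ,Δ₅ψ⟩ = ½w⟨ψ_o,Δ₅⁽⁷⁾ψ_o⟩ − c²w⟨ψ_o,QC7Q*(Λ′₆∩Λ′₇ᶜ)ψ⟩ +
    ½w⟨ψ_i,Δ₂ψ_i⟩ + (−½c²w⟨ψ_o,Qδ₇CQ*ψ_o⟩ − c²w⟨ψ_o,Qδ₇CQ*(Λ′₆∩Λ′₇ᶜ)ψ⟩ − c²w⟨ψ_o,QC_{Λ₅}Q*Λ′₇ψ⟩ − ½c²w⟨ψ_i,Q(C_{Λ₅}−C2)Q*ψ_i⟩)`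
    EXACTLY (hypotheses: `Q* = L^dQᵀ`, `C_{Λ₅}` symmetric, `Λ′₇ ⊆ Λ′₆ ⊆ Λ′₅`);
 §2 `abs_out_le`, **`eq240_rowdamped_bound`** (the row-damped replacement engine against `Λ′₆ᶜψ`), **`eq240_far_bound`**
    (= the (2.37) far bound after the Dirichlet restriction), **`eq240_error_bound`** (the four terms), **`eq240_error_pow`**
    (`≤ 3c²|w|q₁qs₁c₀Ssum·C_κℓ^κ·|Λ′₅|`).
HONEST SCOPE.  As in the sibling files: kernels are data, the printed structural facts (adjointness, Dirichlet supports,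
symmetry, decay shapes, separations) are HYPOTHESES in the printed form; the volume factor is `|Λ′₅|` (number of blocks;
the print writes `|Λ₅|`); nothing about the functional integral (2.33) is asserted.
-/

namespace Literature.MathematicalPhysics.QuantumFieldTheory.Balaban1983to89.B2Eq240ScalarForm

open Real Matrix
open B2Eq218Translation (restrict)
open B2Eq224FirstStepFields (delta227)
open B2Eq236Replacements (abs_Qs_restrict_le pFn_nonneg)
open B2Eq237FormSplit (delta227_transpose half_form_split dot_delta227_mulVec sum_out_mul_in_eq_zero
  dot_Q_covΛ_eq_restrict restrict_out_eq restrict_split form_delta_diff dot_Q_K_eq_sum sum_abs_vecMul_le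
  sum_abs_restrict_le exists_of_vecMul_restrict_ne_zero eq237_far_bound eq237_damped_bound rFn_nonneg)
open B2Eq238ScalarBoundary (bilin_rowdamped_bound abs_Qs_mulVec_le_of_mem)

variable {X Y : Type*} [Fintype X] [Fintype Y] [DecidableEq Y]

/-! ## §1 **(2.40)**, the exact identity -/

/-- Replacing the kernel in (2.27): `⟨u, Δ_Λ[K₁]v⟩ = ⟨u, Δ_Λ[K₂]v⟩ − c²⟨u, Q(K₁ − K₂)Q*v⟩`.
[cite: Balaban1982Higgs2, (2.27) p.562] -/
theorem dot_delta227_kernel_sub (c : ℝ) (Λ' : Finset Y) (Q : Matrix Y X ℝ) (K₁ K₂ : Matrix X X ℝ) (Qs : Matrix X Y ℝ)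
    (u v : Y → ℝ) :
    u ⬝ᵥ (delta227 c Λ' Q K₁ Qs *ᵥ v)
      = u ⬝ᵥ (delta227 c Λ' Q K₂ Qs *ᵥ v) - c ^ 2 * (u ⬝ᵥ (Q *ᵥ ((K₁ - K₂) *ᵥ (Qs *ᵥ v)))) := by
  rw [dot_delta227_mulVec, dot_delta227_mulVec, Matrix.sub_mulVec, Matrix.mulVec_sub, dotProduct_sub]
  ring

/-- The cross term `⟨u, QC_{Λ₅}Q*Λ′₆ψ⟩` split along `Λ′₆ψ = (Λ′₆∩Λ′₇ᶜ)ψ + Λ′₇ψ` and the kernel replacement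
`C_{Λ₅} = C7 + δ₇C` in the first part. [cite: Balaban1982Higgs2, (2.40) p.565] -/
theorem dot_QKQs_split {Λ₆' Λ₇' : Finset Y} (h7 : Λ₇' ⊆ Λ₆') (Q : Matrix Y X ℝ) (CΛ C7 : Matrix X X ℝ)
    (Qs : Matrix X Y ℝ) (ψ u : Y → ℝ) :
    u ⬝ᵥ (Q *ᵥ (CΛ *ᵥ (Qs *ᵥ restrict Λ₆' ψ)))
      = u ⬝ᵥ (Q *ᵥ (C7 *ᵥ (Qs *ᵥ restrict (Λ₆' \ Λ₇') ψ)))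
        + u ⬝ᵥ (Q *ᵥ ((CΛ - C7) *ᵥ (Qs *ᵥ restrict (Λ₆' \ Λ₇') ψ)))
        + u ⬝ᵥ (Q *ᵥ (CΛ *ᵥ (Qs *ᵥ restrict Λ₇' ψ))) := by
  rw [restrict_split h7 ψ, Matrix.mulVec_add, Matrix.mulVec_add, Matrix.mulVec_add, dotProduct_add,
    Matrix.sub_mulVec, Matrix.mulVec_sub, dotProduct_sub]
  ring

/-- **(2.40), EXACT form**: with `ψ_o := ψ − Λ′₆ψ`, `ψ_i := Λ′₆ψ`, `Δ₅ := Δ^{(1),L}_{Λ₅}(B^{(1)})` (kernel `C_{Λ₅}`), `Δ₅⁽⁷⁾` the same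
with `C7 = C^{(0)}_{Λ₅}(Λ₇ᶜ,B^{(1)})`, `Δ₂` the whole-lattice operator with `C2 = C^{(0)}(Λ₂,B^{(1)})`:
`½w⟨ψ,Δ₅ψ⟩ = ½w⟨ψ_o,Δ₅⁽⁷⁾ψ_o⟩ − c²w⟨ψ_o, QC7Q*(Λ′₆∩Λ′₇ᶜ)ψ⟩ + ½w⟨ψ_i,Δ₂ψ_i⟩ + (−½c²w⟨ψ_o,Q(C_{Λ₅}−C7)Q*ψ_o⟩ −
c²w⟨ψ_o,Q(C_{Λ₅}−C7)Q*(Λ′₆∩Λ′₇ᶜ)ψ⟩ − c²w⟨ψ_o,QC_{Λ₅}Q*Λ′₇ψ⟩ − ½c²w⟨ψ_i,Q(C_{Λ₅}−C2)Q*ψ_i⟩)`, the bracket being the printed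
`O(ε^κ)|Λ₅|` (`eq240_error_bound`). [cite: Balaban1982Higgs2, (2.40) p.565] -/
theorem eq240_exact {c w : ℝ} {Λ' Λ₆' Λ₇' : Finset Y} {Q : Matrix Y X ℝ} {Qs : Matrix X Y ℝ} {CΛ : Matrix X X ℝ}
    (hQs : Qs = w • Qᵀ) (hC : CΛᵀ = CΛ) (h6 : Λ₆' ⊆ Λ') (h7 : Λ₇' ⊆ Λ₆') (C7 C2 : Matrix X X ℝ) (ψ : Y → ℝ) :
    1 / 2 * (w * (ψ ⬝ᵥ (delta227 c Λ' Q CΛ Qs *ᵥ ψ)))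
      = 1 / 2 * (w * ((ψ - restrict Λ₆' ψ) ⬝ᵥ (delta227 c Λ' Q C7 Qs *ᵥ (ψ - restrict Λ₆' ψ))))
        - c ^ 2 * (w * ((ψ - restrict Λ₆' ψ) ⬝ᵥ (Q *ᵥ (C7 *ᵥ (Qs *ᵥ restrict (Λ₆' \ Λ₇') ψ)))))
        + 1 / 2 * (w * (restrict Λ₆' ψ ⬝ᵥ (delta227 c Finset.univ Q C2 Qs *ᵥ restrict Λ₆' ψ)))
        + (-(1 / 2 * c ^ 2 * (w * ((ψ - restrict Λ₆' ψ) ⬝ᵥ (Q *ᵥ ((CΛ - C7) *ᵥ (Qs *ᵥ (ψ - restrict Λ₆' ψ)))))))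
          - c ^ 2 * (w * ((ψ - restrict Λ₆' ψ) ⬝ᵥ (Q *ᵥ ((CΛ - C7) *ᵥ (Qs *ᵥ restrict (Λ₆' \ Λ₇') ψ)))))
          - c ^ 2 * (w * ((ψ - restrict Λ₆' ψ) ⬝ᵥ (Q *ᵥ (CΛ *ᵥ (Qs *ᵥ restrict Λ₇' ψ)))))
          - 1 / 2 * c ^ 2 * (w * (restrict Λ₆' ψ ⬝ᵥ (Q *ᵥ ((CΛ - C2) *ᵥ (Qs *ᵥ restrict Λ₆' ψ)))))) := by
  have hsym := delta227_transpose hQs hC c Λ'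
  have hsplit : 1 / 2 * (ψ ⬝ᵥ (delta227 c Λ' Q CΛ Qs *ᵥ ψ))
      = 1 / 2 * ((ψ - restrict Λ₆' ψ) ⬝ᵥ (delta227 c Λ' Q CΛ Qs *ᵥ (ψ - restrict Λ₆' ψ)))
        + (ψ - restrict Λ₆' ψ) ⬝ᵥ (delta227 c Λ' Q CΛ Qs *ᵥ restrict Λ₆' ψ)
        + 1 / 2 * (restrict Λ₆' ψ ⬝ᵥ (delta227 c Λ' Q CΛ Qs *ᵥ restrict Λ₆' ψ)) := by
    have h := half_form_split hsym (ψ - restrict Λ₆' ψ) (restrict Λ₆' ψ)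
    rwa [sub_add_cancel] at h
  have h1 := dot_delta227_kernel_sub c Λ' Q CΛ C7 Qs (ψ - restrict Λ₆' ψ) (ψ - restrict Λ₆' ψ)
  have h2 := dot_delta227_mulVec c Λ' Q CΛ Qs (ψ - restrict Λ₆' ψ) (restrict Λ₆' ψ)
  have h0 := sum_out_mul_in_eq_zero Λ' Λ₆' ψ
  have h3 := dot_QKQs_split h7 Q CΛ C7 Qs ψ (ψ - restrict Λ₆' ψ)
  have h4 := form_delta_diff c h6 Q CΛ C2 Qs ψ
  have e0 : 1 / 2 * (w * (ψ ⬝ᵥ (delta227 c Λ' Q CΛ Qs *ᵥ ψ)))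
      = w * (1 / 2 * (ψ ⬝ᵥ (delta227 c Λ' Q CΛ Qs *ᵥ ψ))) := by ring
  rw [e0, hsplit, h1, h2, h0, h3, h4]
  ring

/-! ## §2 **(2.40)**, the error `O(ε^κ)|Λ₅|` -/

omit [Fintype X] [Fintype Y] in
/-- `|Λ′₆ᶜψ| ≤ Gψ` on `Λ′₅` if `|ψ| ≤ Gψ` there (`Gψ ≥ 0`). [cite: Balaban1982Higgs2, (2.17) p.560] -/
theorem abs_out_le {Λ' Λ₆' : Finset Y} {ψ : Y → ℝ} {Gψ : ℝ} (hGψ : 0 ≤ Gψ) (hψ : ∀ y ∈ Λ', |ψ y| ≤ Gψ) :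
    ∀ y ∈ Λ', |(ψ - restrict Λ₆' ψ) y| ≤ Gψ := by
  intro y hy
  rw [Pi.sub_apply]
  unfold restrict
  split_ifs
  · rw [sub_self, abs_zero]
    exact hGψ
  · rw [sub_zero]
    exact hψ y hy

/-- **The row-damped replacement against `Λ′₆ᶜψ`**: for a kernel difference `δ₇C = C_{Λ₅} − C7` (both Dirichlet-supported in
`Λ₅ × Λ₅`) of the row-damped shape `|δ₇C(x,x″)| ≤ c₀e^{−δ(d(x,x″) + v(x))}` on the rows `x ∈ Λ₅` with `v(x) ≥ R`, and fine
points under the blocks of `Λ′₅∖Λ′₆` having `v ≥ R` ((2.8)): `|⟨Λ′₆ᶜψ, Qδ₇C g⟩| ≤ (|Λ′₅|Gψq₁)·c₀e^{−δR}·G·Ssum` for `|g| ≤ G`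
on `Λ₅`. [cite: Balaban1982Higgs2, (2.40) p.565] -/
theorem eq240_rowdamped_bound {Λ : Finset X} {Λ' Λ₆' : Finset Y} {Q : Matrix Y X ℝ} {CΛ C7 : Matrix X X ℝ}
    {ψ : Y → ℝ} {g : X → ℝ} {d : X → X → ℝ} {v : X → ℝ} {c₀ δ R Gψ q₁ G Ssum : ℝ}
    (hc₀ : 0 ≤ c₀) (hδ : 0 ≤ δ) (hGψ : 0 ≤ Gψ) (hq : 0 ≤ q₁) (hG : 0 ≤ G) (hS0 : 0 ≤ Ssum)
    (hQ : ∀ y x, Q y x ≠ 0 → (x ∈ Λ ↔ y ∈ Λ'))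
    (hCs : ∀ x x', CΛ x x' ≠ 0 → x ∈ Λ ∧ x' ∈ Λ) (hCs7 : ∀ x x', C7 x x' ≠ 0 → x ∈ Λ ∧ x' ∈ Λ)
    (hδ7 : ∀ x ∈ Λ, R ≤ v x → ∀ x'' ∈ Λ, |CΛ x x'' - C7 x x''| ≤ c₀ * Real.exp (-(δ * (d x x'' + v x))))
    (hd : ∀ x x'', 0 ≤ d x x'') (hdeep7 : ∀ y ∈ Λ', y ∉ Λ₆' → ∀ x, Q y x ≠ 0 → R ≤ v x)
    (hψ : ∀ y ∈ Λ', |ψ y| ≤ Gψ) (hQ1 : ∀ y, ∑ x, |Q y x| ≤ q₁) (hg : ∀ x'' ∈ Λ, |g x''| ≤ G)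
    (hS : ∀ x, ∑ x'', Real.exp (-(δ / 2 * d x x'')) ≤ Ssum) :
    |(ψ - restrict Λ₆' ψ) ⬝ᵥ (Q *ᵥ ((CΛ - C7) *ᵥ g))| ≤ (Λ'.card * Gψ * q₁) * (c₀ * Real.exp (-(δ * R)) * G * Ssum) := by
  have hCsδ : ∀ x x', (CΛ - C7) x x' ≠ 0 → x ∈ Λ ∧ x' ∈ Λ := by
    intro x x' h
    rw [Matrix.sub_apply] at h
    by_cases h1 : CΛ x x' = 0
    · rw [h1, zero_sub, neg_ne_zero] at h
      exact hCs7 x x' h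
    · exact hCs x x' h1
  rw [dot_Q_covΛ_eq_restrict hQ hCsδ (ψ - restrict Λ₆' ψ), restrict_out_eq, dot_Q_K_eq_sum]
  have hK0 : ∀ x x'', x'' ∉ Λ → (CΛ - C7) x x'' = 0 := by
    intro x x'' hx''
    by_contra h
    exact hx'' (hCsδ x x'' h).2
  have hre : ∑ x, ∑ x'', (∑ y, restrict (Λ' \ Λ₆') ψ y * Q y x) * (CΛ - C7) x x'' * g x''
      = ∑ x ∈ (Finset.univ : Finset X).filter (fun x => R ≤ v x), ∑ x'' ∈ Λ,
          (∑ y, restrict (Λ' \ Λ₆') ψ y * Q y x) * (CΛ - C7) x x'' * g x'' := by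
    symm
    refine (Finset.sum_subset (Finset.filter_subset _ _) fun x _ hxf => ?_).trans
      (Finset.sum_congr rfl fun x _ => Finset.sum_subset (Finset.subset_univ Λ) fun x'' _ hx'' => ?_)
    · have h0 : (∑ y, restrict (Λ' \ Λ₆') ψ y * Q y x) = 0 := by
        by_contra h0
        obtain ⟨y, hyS, hyQ⟩ := exists_of_vecMul_restrict_ne_zero h0
        rw [Finset.mem_sdiff] at hyS
        exact hxf (Finset.mem_filter.2 ⟨Finset.mem_univ x, hdeep7 y hyS.1 hyS.2 x hyQ⟩)
      exact Finset.sum_eq_zero fun x'' _ => by rw [h0, zero_mul, zero_mul]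
    · rw [hK0 x x'' hx'', mul_zero, zero_mul]
  rw [hre]
  have hF : ∑ x ∈ (Finset.univ : Finset X).filter (fun x => R ≤ v x), |∑ y, restrict (Λ' \ Λ₆') ψ y * Q y x|
      ≤ Λ'.card * Gψ * q₁ :=
    (Finset.sum_le_sum_of_subset_of_nonneg (Finset.filter_subset _ _) fun _ _ _ => abs_nonneg _).trans
      ((sum_abs_vecMul_le hQ1).trans
        (mul_le_mul_of_nonneg_right (sum_abs_restrict_le Finset.sdiff_subset hGψ hψ) hq))
  refine bilin_rowdamped_bound (u := v) (Dk := fun x x'' => (CΛ - C7) x x'') hc₀ hδ hG hF ?_ ?_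
    (fun x _ x'' _ => hd x x'') hg hS0 ?_
  · intro x hx x'' hx''
    by_cases hxΛ : x ∈ Λ
    · rw [Matrix.sub_apply]
      exact hδ7 x hxΛ (Finset.mem_filter.1 hx).2 x'' hx''
    · have h0 : (CΛ - C7) x x'' = 0 := by
        by_contra h
        exact hxΛ (hCsδ x x'' h).1
      rw [h0, abs_zero]
      positivity
  · intro x hx _
    exact (Finset.mem_filter.1 hx).2
  · intro x _
    exact (Finset.sum_le_sum_of_subset_of_nonneg (Finset.subset_univ Λ) fun _ _ _ => (Real.exp_pos _).le).trans
      (hS x)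

/-- **(2.40), the far term** — literally the far term of (2.37) after the Dirichlet restriction `ψ_o ↦ (Λ′₅∩Λ′₆ᶜ)ψ`:
`|c²w⟨Λ′₆ᶜψ, QC_{Λ₅}Q*Λ′₇ψ⟩| ≤ c²|w|·(|Λ′₅|Gψq₁)·c₀e^{−½δ₀R}·(qs₁Gψ)·Ssum`. [cite: Balaban1982Higgs2, (2.40) p.565] -/
theorem eq240_far_bound [DecidableEq X] {c w : ℝ} {Λ : Finset X} {Λ' Λ₆' Λ₇' : Finset Y} {Q : Matrix Y X ℝ}
    {Qs : Matrix X Y ℝ} {CΛ : Matrix X X ℝ} {ψ : Y → ℝ} {d : X → X → ℝ} {c₀ δ R Gψ q₁ qs₁ Ssum : ℝ}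
    (hc₀ : 0 ≤ c₀) (hδ : 0 ≤ δ) (hGψ : 0 ≤ Gψ) (hq : 0 ≤ q₁) (hqs : 0 ≤ qs₁) (hS0 : 0 ≤ Ssum) (h6 : Λ₆' ⊆ Λ')
    (h7 : Λ₇' ⊆ Λ₆') (hQ : ∀ y x, Q y x ≠ 0 → (x ∈ Λ ↔ y ∈ Λ')) (hCs : ∀ x x', CΛ x x' ≠ 0 → x ∈ Λ ∧ x' ∈ Λ)
    (hK : ∀ x x'', |CΛ x x''| ≤ c₀ * Real.exp (-(δ * d x x'')))
    (hψ : ∀ y ∈ Λ', |ψ y| ≤ Gψ) (hQ1 : ∀ y, ∑ x, |Q y x| ≤ q₁) (hQs1 : ∀ x'', ∑ y, |Qs x'' y| ≤ qs₁)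
    (hsep : ∀ x x'' y y', y ∈ Λ' → y ∉ Λ₆' → Q y x ≠ 0 → y' ∈ Λ₇' → Qs x'' y' ≠ 0 → R ≤ d x x'')
    (hS : ∀ x, ∑ x'', Real.exp (-(δ / 2 * d x x'')) ≤ Ssum) :
    |c ^ 2 * (w * ((ψ - restrict Λ₆' ψ) ⬝ᵥ (Q *ᵥ (CΛ *ᵥ (Qs *ᵥ restrict Λ₇' ψ)))))|
      ≤ c ^ 2 * |w| * ((Λ'.card * Gψ * q₁) * (c₀ * Real.exp (-(δ / 2 * R)) * (qs₁ * Gψ) * Ssum)) := by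
  rw [dot_Q_covΛ_eq_restrict hQ hCs (ψ - restrict Λ₆' ψ), restrict_out_eq]
  exact eq237_far_bound hc₀ hδ hGψ hq hqs hS0 h6 h7 hK hψ hQ1 hQs1 hsep hS

omit [Fintype X] [Fintype Y] [DecidableEq Y] in
/-- `|a·(w·T)| = a·|w|·|T|` for `a ≥ 0`. [folklore] [cite: Balaban1982Higgs2, (2.40) p.565] -/
theorem abs_coef_mul {a : ℝ} (ha : 0 ≤ a) (w T : ℝ) : |a * (w * T)| = a * |w| * |T| := by
  rw [abs_mul, abs_mul, abs_of_nonneg ha]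
  ring

/-- **(2.40), the error bound**: the bracket of `eq240_exact` is bounded by
`½c²|w|·F·E₁ + c²|w|·F·E₁ + c²|w|·F·E_½ + ½c²|w|·F·E₁` with `F = |Λ′₅|Gψq₁`, `E₁ = c₀e^{−δ₀R}qs₁GψSsum`,
`E_½ = c₀e^{−½δ₀R}qs₁GψSsum` — the printed `O(ε^κ)|Λ₅|` with its constants. [cite: Balaban1982Higgs2, (2.40) p.565] -/
theorem eq240_error_bound [DecidableEq X] {c w : ℝ} {Λ : Finset X} {Λ' Λ₆' Λ₇' : Finset Y} {Q : Matrix Y X ℝ}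
    {Qs : Matrix X Y ℝ} {CΛ C7 C2 : Matrix X X ℝ} {ψ : Y → ℝ} {d : X → X → ℝ} {u v : X → ℝ}
    {c₀ δ R Gψ q₁ qs₁ Ssum : ℝ}
    (hc₀ : 0 ≤ c₀) (hδ : 0 ≤ δ) (hGψ : 0 ≤ Gψ) (hq : 0 ≤ q₁) (hqs : 0 ≤ qs₁) (hS0 : 0 ≤ Ssum) (h6 : Λ₆' ⊆ Λ')
    (h7 : Λ₇' ⊆ Λ₆') (hQs : Qs = w • Qᵀ) (hQ : ∀ y x, Q y x ≠ 0 → (x ∈ Λ ↔ y ∈ Λ'))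
    (hCs : ∀ x x', CΛ x x' ≠ 0 → x ∈ Λ ∧ x' ∈ Λ) (hCs7 : ∀ x x', C7 x x' ≠ 0 → x ∈ Λ ∧ x' ∈ Λ)
    (hK : ∀ x x'', |CΛ x x''| ≤ c₀ * Real.exp (-(δ * d x x'')))
    (hδ7 : ∀ x ∈ Λ, R ≤ v x → ∀ x'' ∈ Λ, |CΛ x x'' - C7 x x''| ≤ c₀ * Real.exp (-(δ * (d x x'' + v x))))
    (hδC2 : ∀ x ∈ Λ, ∀ x'' ∈ Λ, |CΛ x x'' - C2 x x''| ≤ c₀ * Real.exp (-(δ * (d x x'' + u x + u x''))))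
    (hd : ∀ x x'', 0 ≤ d x x'') (hu : ∀ x, 0 ≤ u x)
    (hdeep6 : ∀ y ∈ Λ₆', ∀ x, Q y x ≠ 0 → R ≤ u x) (hdeep7 : ∀ y ∈ Λ', y ∉ Λ₆' → ∀ x, Q y x ≠ 0 → R ≤ v x)
    (hsep : ∀ x x'' y y', y ∈ Λ' → y ∉ Λ₆' → Q y x ≠ 0 → y' ∈ Λ₇' → Qs x'' y' ≠ 0 → R ≤ d x x'')
    (hψ : ∀ y ∈ Λ', |ψ y| ≤ Gψ) (hQ1 : ∀ y, ∑ x, |Q y x| ≤ q₁) (hQs1 : ∀ x'', ∑ y, |Qs x'' y| ≤ qs₁)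
    (hS : ∀ x, ∑ x'', Real.exp (-(δ / 2 * d x x'')) ≤ Ssum) :
    |(-(1 / 2 * c ^ 2 * (w * ((ψ - restrict Λ₆' ψ) ⬝ᵥ (Q *ᵥ ((CΛ - C7) *ᵥ (Qs *ᵥ (ψ - restrict Λ₆' ψ))))))))
        - c ^ 2 * (w * ((ψ - restrict Λ₆' ψ) ⬝ᵥ (Q *ᵥ ((CΛ - C7) *ᵥ (Qs *ᵥ restrict (Λ₆' \ Λ₇') ψ)))))
        - c ^ 2 * (w * ((ψ - restrict Λ₆' ψ) ⬝ᵥ (Q *ᵥ (CΛ *ᵥ (Qs *ᵥ restrict Λ₇' ψ)))))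
        - 1 / 2 * c ^ 2 * (w * (restrict Λ₆' ψ ⬝ᵥ (Q *ᵥ ((CΛ - C2) *ᵥ (Qs *ᵥ restrict Λ₆' ψ)))))|
      ≤ 1 / 2 * c ^ 2 * |w| * ((Λ'.card * Gψ * q₁) * (c₀ * Real.exp (-(δ * R)) * (qs₁ * Gψ) * Ssum))
        + c ^ 2 * |w| * ((Λ'.card * Gψ * q₁) * (c₀ * Real.exp (-(δ * R)) * (qs₁ * Gψ) * Ssum))
        + c ^ 2 * |w| * ((Λ'.card * Gψ * q₁) * (c₀ * Real.exp (-(δ / 2 * R)) * (qs₁ * Gψ) * Ssum))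
        + 1 / 2 * c ^ 2 * |w| * ((Λ'.card * Gψ * q₁) * (c₀ * Real.exp (-(δ * R)) * (qs₁ * Gψ) * Ssum)) := by
  have hgo : ∀ x'' ∈ Λ, |(Qs *ᵥ (ψ - restrict Λ₆' ψ)) x''| ≤ qs₁ * Gψ := fun x'' hx'' =>
    abs_Qs_mulVec_le_of_mem hQs hQ hGψ (abs_out_le hGψ hψ) hQs1 hx''
  have hψ67 : ∀ y ∈ Λ₆' \ Λ₇', |ψ y| ≤ Gψ := fun y hy => hψ y (h6 (Finset.mem_sdiff.1 hy).1)
  have hg67 : ∀ x'' ∈ Λ, |(Qs *ᵥ restrict (Λ₆' \ Λ₇') ψ) x''| ≤ qs₁ * Gψ := fun x'' _ =>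
    abs_Qs_restrict_le hGψ hψ67 hQs1 x''
  have E1 := eq240_rowdamped_bound hc₀ hδ hGψ hq (mul_nonneg hqs hGψ) hS0 hQ hCs hCs7 hδ7 hd hdeep7 hψ hQ1 hgo hS
  have E2 := eq240_rowdamped_bound hc₀ hδ hGψ hq (mul_nonneg hqs hGψ) hS0 hQ hCs hCs7 hδ7 hd hdeep7 hψ hQ1 hg67 hS
  have E3 := eq240_far_bound (c := c) (w := w) hc₀ hδ hGψ hq hqs hS0 h6 h7 hQ hCs hK hψ hQ1 hQs1 hsep hS
  have E4 := eq237_damped_bound (c := c) hc₀ hδ hGψ hq hqs hS0 h6 hQs hQ hδC2 hd hu hdeep6 hψ hQ1 hQs1 hS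
  have hc2 : (0 : ℝ) ≤ c ^ 2 := sq_nonneg c
  have hc2' : (0 : ℝ) ≤ 1 / 2 * c ^ 2 := by positivity
  refine (abs_sub _ _).trans (add_le_add ((abs_sub _ _).trans (add_le_add ((abs_sub _ _).trans (add_le_add ?_ ?_)) ?_))
    E4)
  · rw [abs_neg, abs_coef_mul hc2']
    exact mul_le_mul_of_nonneg_left E1 (by positivity)
  · rw [abs_coef_mul hc2]
    exact mul_le_mul_of_nonneg_left E2 (by positivity)
  · exact E3

/-- **(2.40), "for arbitrary κ"**: with `R ≥ r(ℓ) ≥ 0` ((2.7)–(2.8)) and `e^{−½δ₀r(ℓ)}·Gψ² ≤ C_κℓ^κ` (`decay_thresholds_pow₂`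
at the printed threshold for `|ψ|`), the error of (2.40) is `≤ 3c²|w|q₁qs₁c₀·Ssum·C_κℓ^κ·|Λ′₅|` — *"O(ε^κ)|Λ₅|"*.
[cite: Balaban1982Higgs2, (2.40) p.565] -/
theorem eq240_error_pow [DecidableEq X] {c w : ℝ} {Λ : Finset X} {Λ' Λ₆' Λ₇' : Finset Y} {Q : Matrix Y X ℝ}
    {Qs : Matrix X Y ℝ} {CΛ C7 C2 : Matrix X X ℝ} {ψ : Y → ℝ} {d : X → X → ℝ} {u v : X → ℝ}
    {c₀ δ R Gψ q₁ qs₁ Ssum Rr r ℓ κ Cκ : ℝ}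
    (hc₀ : 0 ≤ c₀) (hδ : 0 ≤ δ) (hGψ : 0 ≤ Gψ) (hq : 0 ≤ q₁) (hqs : 0 ≤ qs₁) (hS0 : 0 ≤ Ssum)
    (hRr0 : 0 ≤ Rr) (hℓ : 0 < ℓ) (hℓ1 : ℓ ≤ 1) (hRr : B2.rFn Rr r ℓ ≤ R)
    (hCκ : Real.exp (-(δ / 2 * B2.rFn Rr r ℓ)) * (Gψ * Gψ) ≤ Cκ * ℓ ^ κ)
    (h6 : Λ₆' ⊆ Λ') (h7 : Λ₇' ⊆ Λ₆') (hQs : Qs = w • Qᵀ) (hQ : ∀ y x, Q y x ≠ 0 → (x ∈ Λ ↔ y ∈ Λ'))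
    (hCs : ∀ x x', CΛ x x' ≠ 0 → x ∈ Λ ∧ x' ∈ Λ) (hCs7 : ∀ x x', C7 x x' ≠ 0 → x ∈ Λ ∧ x' ∈ Λ)
    (hK : ∀ x x'', |CΛ x x''| ≤ c₀ * Real.exp (-(δ * d x x'')))
    (hδ7 : ∀ x ∈ Λ, R ≤ v x → ∀ x'' ∈ Λ, |CΛ x x'' - C7 x x''| ≤ c₀ * Real.exp (-(δ * (d x x'' + v x))))
    (hδC2 : ∀ x ∈ Λ, ∀ x'' ∈ Λ, |CΛ x x'' - C2 x x''| ≤ c₀ * Real.exp (-(δ * (d x x'' + u x + u x''))))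
    (hd : ∀ x x'', 0 ≤ d x x'') (hu : ∀ x, 0 ≤ u x)
    (hdeep6 : ∀ y ∈ Λ₆', ∀ x, Q y x ≠ 0 → R ≤ u x) (hdeep7 : ∀ y ∈ Λ', y ∉ Λ₆' → ∀ x, Q y x ≠ 0 → R ≤ v x)
    (hsep : ∀ x x'' y y', y ∈ Λ' → y ∉ Λ₆' → Q y x ≠ 0 → y' ∈ Λ₇' → Qs x'' y' ≠ 0 → R ≤ d x x'')
    (hψ : ∀ y ∈ Λ', |ψ y| ≤ Gψ) (hQ1 : ∀ y, ∑ x, |Q y x| ≤ q₁) (hQs1 : ∀ x'', ∑ y, |Qs x'' y| ≤ qs₁)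
    (hS : ∀ x, ∑ x'', Real.exp (-(δ / 2 * d x x'')) ≤ Ssum) :
    |(-(1 / 2 * c ^ 2 * (w * ((ψ - restrict Λ₆' ψ) ⬝ᵥ (Q *ᵥ ((CΛ - C7) *ᵥ (Qs *ᵥ (ψ - restrict Λ₆' ψ))))))))
        - c ^ 2 * (w * ((ψ - restrict Λ₆' ψ) ⬝ᵥ (Q *ᵥ ((CΛ - C7) *ᵥ (Qs *ᵥ restrict (Λ₆' \ Λ₇') ψ)))))
        - c ^ 2 * (w * ((ψ - restrict Λ₆' ψ) ⬝ᵥ (Q *ᵥ (CΛ *ᵥ (Qs *ᵥ restrict Λ₇' ψ)))))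
        - 1 / 2 * c ^ 2 * (w * (restrict Λ₆' ψ ⬝ᵥ (Q *ᵥ ((CΛ - C2) *ᵥ (Qs *ᵥ restrict Λ₆' ψ)))))|
      ≤ 3 * c ^ 2 * |w| * q₁ * qs₁ * c₀ * Ssum * (Cκ * ℓ ^ κ) * Λ'.card := by
  have h1 := eq240_error_bound hc₀ hδ hGψ hq hqs hS0 h6 h7 hQs hQ hCs hCs7 hK hδ7 hδC2 hd hu hdeep6 hdeep7 hsep hψ hQ1
    hQs1 hS (c := c)
  have hR0 : 0 ≤ R := (rFn_nonneg hRr0 hℓ hℓ1).trans hRr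
  have hexp : Real.exp (-(δ / 2 * R)) ≤ Real.exp (-(δ / 2 * B2.rFn Rr r ℓ)) := by
    rw [Real.exp_le_exp]
    have := mul_le_mul_of_nonneg_left hRr (by positivity : (0 : ℝ) ≤ δ / 2)
    linarith
  have hexp2 : Real.exp (-(δ * R)) ≤ Real.exp (-(δ / 2 * R)) := by
    rw [Real.exp_le_exp]
    have := mul_nonneg hδ hR0
    linarith
  have h2 : Real.exp (-(δ / 2 * R)) * (Gψ * Gψ) ≤ Cκ * ℓ ^ κ :=
    (mul_le_mul_of_nonneg_right hexp (mul_nonneg hGψ hGψ)).trans hCκ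
  have h3 : Real.exp (-(δ * R)) * (Gψ * Gψ) ≤ Cκ * ℓ ^ κ :=
    (mul_le_mul_of_nonneg_right hexp2 (mul_nonneg hGψ hGψ)).trans h2
  have hA : 0 ≤ c ^ 2 * |w| * q₁ * qs₁ * c₀ * Ssum * Λ'.card := by positivity
  refine h1.trans ?_
  calc 1 / 2 * c ^ 2 * |w| * ((Λ'.card * Gψ * q₁) * (c₀ * Real.exp (-(δ * R)) * (qs₁ * Gψ) * Ssum))
        + c ^ 2 * |w| * ((Λ'.card * Gψ * q₁) * (c₀ * Real.exp (-(δ * R)) * (qs₁ * Gψ) * Ssum))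
        + c ^ 2 * |w| * ((Λ'.card * Gψ * q₁) * (c₀ * Real.exp (-(δ / 2 * R)) * (qs₁ * Gψ) * Ssum))
        + 1 / 2 * c ^ 2 * |w| * ((Λ'.card * Gψ * q₁) * (c₀ * Real.exp (-(δ * R)) * (qs₁ * Gψ) * Ssum))
      = 2 * (c ^ 2 * |w| * q₁ * qs₁ * c₀ * Ssum * Λ'.card) * (Real.exp (-(δ * R)) * (Gψ * Gψ))
        + (c ^ 2 * |w| * q₁ * qs₁ * c₀ * Ssum * Λ'.card) * (Real.exp (-(δ / 2 * R)) * (Gψ * Gψ)) := by ring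
    _ ≤ 2 * (c ^ 2 * |w| * q₁ * qs₁ * c₀ * Ssum * Λ'.card) * (Cκ * ℓ ^ κ)
        + (c ^ 2 * |w| * q₁ * qs₁ * c₀ * Ssum * Λ'.card) * (Cκ * ℓ ^ κ) :=
        add_le_add (mul_le_mul_of_nonneg_left h3 (by positivity)) (mul_le_mul_of_nonneg_left h2 hA)
    _ = 3 * c ^ 2 * |w| * q₁ * qs₁ * c₀ * Ssum * (Cκ * ℓ ^ κ) * Λ'.card := by ring

end Literature.MathematicalPhysics.QuantumFieldTheory.Balaban1983to89.B2Eq240ScalarForm
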